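import Mathlib
import Summits.Ventures.PercRepro2.LocRows
import Summits.Ventures.PercRepro2.SwRow
import Summits.Ventures.PercRepro2.SwOut
import Summits.Ventures.PercRepro2.SwAllRow
import Summits.Ventures.PercRepro2.SwOutAll
import Summits.Ventures.PercRepro2.SwOutArmFlip
import Summits.Ventures.PercRepro2.SwOutArmThm
import Summits.Ventures.PercRepro2.SwOutCoreDefs
import Summits.Ventures.PercRepro2.SwOutCoreHull
import Summits.Ventures.PercRepro2.SwOutCoreDual
import Summits.Ventures.PercRepro2.SwOutShadowDefs
import Summits.Ventures.PercRepro2.SwOutShadowCube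
import Summits.Ventures.PercRepro2.SwOutShadowIneq
import Summits.Ventures.PercRepro2.SwOutCoreShadowDefs
import Summits.Ventures.PercRepro2.SwOutCoreShadow
import Summits.Ventures.PercRepro2.SwOutCoreShadowFlip
import Summits.Ventures.PercRepro2.SwOutCoreShadowEsc
import Summits.Ventures.PercRepro2.SwOutJunction
import Summits.Ventures.PercRepro2.SwOutJunctionRegion
import Summits.Ventures.PercRepro2.SwOutJunctionH1Defs
import Summits.Ventures.PercRepro2.SwOutJunctionH1Arms
import Summits.Ventures.PercRepro2.SwOutCoreToggle
import Summits.Ventures.PercRepro2.SwOutCoreShadowArm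
import Summits.Ventures.PercRepro2.SwOutCoreShadowKey
import Summits.Ventures.PercRepro2.SwOutEdgeDefs
import Summits.Ventures.PercRepro2.SwOutEdgeHull
import Summits.Ventures.PercRepro2.SwOutEdgeDual
import Summits.Ventures.PercRepro2.SwOutEdgeBase
import Summits.Ventures.PercRepro2.SwOutEdgeKey
import Summits.Ventures.PercRepro2.SwOutEdgeShadow
import Summits.Ventures.PercRepro2.SwOutEdgeShadowFlip
import Summits.Ventures.PercRepro2.SwOutEdgeToggle
import Summits.Ventures.PercRepro2.SwOutEdgeShadowArm
import Summits.Ventures.PercRepro2.SwOutEdgeShadowEsc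

/-!
# The key of a shadow point of the adjacent case (blind cell PercRepro2, night-4 g16,
2026-08-26; proofs/NIGHT4-G15.md §4, proofs/NIGHT4-G16.md §4)

`SwOutCoreShadowKey` for an e-core base (the junction `u` adjacent to `h`).  The key of an
escaping configuration `ζ` is read off its coarse flip `ψ = flip (arm ζ h u) ζ` (`psiOf`): the
canonical e-core base `baseOfE ζ = coreBaseOfE ψ`, its arms `armsOf ζ`, and the arms meeting the
hull of `ζ` (`redOf`); the block of a key `(b, S, R)` is the shadow block `shadowBlock b S R`
(unchanged).  THE CONSTANCY THEOREMS: every point of a shadow block lies in the class, has `u` in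
its hull, is escaping when it is a `Q`-point, and its coarse flip is an e-cube point of `b` —
the e-cube point above `coreOf ω₀ ω'` on the X-blue half, its mirror (u-adjacent coordinates AND
the h–u edge toggled) on the X-red half (`CoreBaseE.flip_sX_shadowReal`) — so its base is `b`
(`baseOfE_of_mem_shadowBlock`, by `coreBaseOfE_coreRealE`), its arms are `S` and its red arms
are the non-dropped arms.
-/

namespace Summit.Ventures.PercRepro2

namespace LocRows

open Hull

variable {V : Type*} {E : Type*} [Fintype E] [DecidableEq E]

open scoped Classical

variable {ends : E → Sym2 V}

section Defs

variable (ends : E → Sym2 V) (h u : V)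

/-- The canonical e-core base of the coarse flip. -/
noncomputable def baseOfE (ζ : Config E) : Config E := coreBaseOfE ends (psiOf ends h u ζ) h u

end Defs

/-! ## The coarse flip of a shadow point is an e-cube point -/

section Psi

variable {ι : Type*} {A : ι → Set V} {pure : ι → Prop} {ζ : Config E} {h u : V} {H : Set V}
  (hb : CoreBaseE ends ζ h u H A pure) {ω₀ : Config ι}
  (huB : ¬ uRed ends A u pure (flipAll ω₀))

include hb huB

omit [Fintype E] [DecidableEq E] huB in
/-- **The coarse flip of a shadow point is an e-cube point of the base**: `flip sX` of the
X-blue half is the e-cube point above the core point `coreOf ω₀ ω'` (h–u edge red), of the X-red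
half its mirror — the u-adjacent coordinates AND the h–u edge toggled. -/
theorem CoreBaseE.flip_sX_shadowReal (ω' : Config (Option {i : ι // ¬ uAdjC ends u A i})) :
    flip ends (sX ends u A ω₀) (shadowReal ends (sB ends u A ω₀) (sZ ends u A ω₀) none
      (shadowOf ends u A ω₀ ζ) ω') =
      coreRealE ends A h u ζ (if ω' none = true then
        toggleE (uAdjC ends u A) (withHuRed (coreOf ends u A ω₀ ω'))
        else withHuRed (coreOf ends u A ω₀ ω')) := by
  cases hn : ω' none with
  | false =>
    rw [hb.shadowReal_eq_flip_coreReal_false (coreOf ends u A ω₀ ω') (fun i hi => coreOf_of_uAdjC hi)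
      ω' hn (fun i => coreOf_of_far i), Hull.flip_flip, ← hb.coreRealE_withHuRed]
    simp
  | true =>
    rw [hb.shadowReal_eq_flip_coreReal_true (coreOf ends u A ω₀ ω') (fun i hi => coreOf_of_uAdjC hi)
      ω' hn (fun i => coreOf_of_far i), flip_comm (sX ends u A ω₀) (sX ends u A ω₀ ∪ sZ ends u A ω₀),
      Hull.flip_flip, ← hb.coreRealE_withHuRed, hb.flip_sXZ_coreRealE]
    simp

omit [Fintype E] [DecidableEq E] in
/-- The red cluster of a dropped vertex at an X-red shadow point stays in the dropped arms. -/
theorem CoreBaseE.cluster_subset_sZ_of_none_true (ω' : Config (Option {i : ι // ¬ uAdjC ends u A i}))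
    (hn : ω' none = true) {z : V} (hz : z ∈ sZ ends u A ω₀) :
    cluster ends (shadowReal ends (sB ends u A ω₀) (sZ ends u A ω₀) none
      (shadowOf ends u A ω₀ ζ) ω') z ⊆ sZ ends u A ω₀ := by
  intro v hv
  refine mem_of_conn_of_closed (ends := ends) (S := sZ ends u A ω₀) ?_ hz hv
  intro a ha b hab
  obtain ⟨_, e, he, hends⟩ := openGraph_adj.1 hab
  obtain ⟨i, hi, hωi, hai⟩ := ha
  have hpi : pure i := CoreBaseE.pure_of_mem_sZ huB hi hωi
  by_cases hbH : b ∈ H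
  · by_cases hbh : b = h
    · exfalso
      subst hbh
      exact hb.pure_no_h i hpi e a (ends_swap hends) hai
    by_cases hbu : b = u
    · exfalso
      subst hbu
      have := hb.shadowReal_uZ huB ω' ⟨i, hi, hωi, hai⟩ (ends_swap hends)
      rw [hn] at this
      rw [this] at he
      exact absurd he (by decide)
    obtain ⟨j, hbj⟩ := hb.arm_cover b hbH hbh hbu
    have hij : i = j := hb.arm_eq_of_edge hends hai hbj
    subst hij
    exact ⟨i, hi, hωi, hbj⟩
  · exfalso
    have := hb.shadowReal_Z_out huB ω' ⟨i, hi, hωi, hai⟩ hends hbH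
    rw [hn] at this
    rw [this] at he
    exact absurd he (by decide)

end Psi

/-! ## The constancy theorems -/

section Key

variable {U : Set V} {ξ : Config E} {l h o u : V} {b : Config E} {S R : Finset (Set V)}

/-- The shadow base lies in the class when the core base does. -/
lemma shadowOf_mem_outClassE {ι : Type*} {A : ι → Set V} {pure : ι → Prop} {H : Set V}
    (hb : CoreBaseE ends b h u H A pure) {ω₀ : Config ι}
    (huB : ¬ uRed ends A u pure (flipAll ω₀)) (hHU : H ⊆ U) (hbcl : b ∈ outClass ends U h ξ) :
    shadowOf ends u A ω₀ b ∈ outClass ends U h ξ := by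
  have hσ : shadowReal ends (sB ends u A ω₀) (sZ ends u A ω₀) none (shadowOf ends u A ω₀ b)
      (fun _ => true) = shadowOf ends u A ω₀ b := by
    unfold shadowReal
    funext e
    apply flip_apply_of_notMem
    rintro ⟨x, hx, _, _⟩
    rcases hx with ⟨j, hj, _⟩ | ⟨hk, _⟩
    · simp at hj
    · simp at hk
  rw [mem_outClass] at hbcl ⊢
  refine ⟨fun e he => ?_, ?_⟩
  · by_cases hue : u ∈ ends e
    · exact absurd ⟨u, hHU hb.u_mem, Sym2.Mem.other hue, (Sym2.other_spec hue).symm⟩ he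
    · rw [shadowOf_apply_of_notMem_u hue, hbcl.1 e he]
  · rw [← hσ, hb.hull_shadowReal_eq huB]
    intro x hx
    apply hHU
    rw [← hb.shadow_region_eq (ω₀ := ω₀)]
    exact Or.inl hx

variable (hl : l ∉ U)
  (hout : ∀ x ∈ U, x ≠ h → x ≠ o → x ≠ u →
    (∃ e y, ends e = s(x, y) ∧ y ∉ U) ∨ (∀ e, x ∉ ends e))
  (hHU : extHull ends b h u ⊆ U) (hS : S = armsC ends h u b)
  (hb : CoreBaseE ends b h u (extHull ends b h u) (armsFun S) (pureFun ends h S))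
  (huB : ¬ uRed ends (armsFun S) u (pureFun ends h S) (flipAll (omegaSR S R)))
  (hbcl : b ∈ outClass ends U h ξ)

include hb huB hHU hbcl in
/-- A point of a shadow block lies in the class. -/
theorem mem_outClass_of_mem_shadowBlockE {ζ' : Config E} (hζ' : ζ' ∈ shadowBlock ends u b S R) :
    ζ' ∈ outClass ends U h ξ := by
  obtain ⟨ω', rfl⟩ := (mem_shadowBlock_iff).1 hζ'
  refine (hb.shadowBase' huB).shadowReal_mem_outClass ?_ (shadowOf_mem_outClassE hb huB hHU hbcl) ω'
  rw [hb.shadow_region_eq]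
  exact hHU

include hb huB in
omit [DecidableEq E] in
/-- `u` lies in the hull of `h` at every point of a shadow block. -/
theorem u_mem_hull_of_mem_shadowBlockE {ζ' : Config E} (hζ' : ζ' ∈ shadowBlock ends u b S R) :
    u ∈ hull ends ζ' h := by
  obtain ⟨ω', rfl⟩ := (mem_shadowBlock_iff).1 hζ'
  exact hb.u_mem_hull_shadowReal huB ω'

include hb huB hl hout hHU in
/-- **A `Q`-point of a shadow block is escaping**: the hull of `u` leaves `U` (a dropped
vertex other than `o` escapes through its outside edge; the dropped vertex `o` is excluded at
the X-red points by `Q` and escapes through `l` at the X-blue points). -/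
theorem not_hull_u_subset_of_mem_shadowBlockE
    (hZ : ∃ P : S, uAdjC ends u (armsFun S) P ∧ omegaSR S R P = false) {ζ' : Config E}
    (hζ' : ζ' ∈ shadowBlock ends u b S R) (hQ : ζ' ∈ tgtU ends l h {T : Set V | o ∈ T}) :
    ¬ hull ends ζ' u ⊆ U := by
  obtain ⟨ω', rfl⟩ := (mem_shadowBlock_iff).1 hζ'
  obtain ⟨P, ⟨e, z, huz, hzP⟩, hωP⟩ := hZ
  have hz : z ∈ sZ ends u (armsFun S) (omegaSR S R) := ⟨P, ⟨e, z, huz, hzP⟩, hωP, hzP⟩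
  have hzH : z ∈ extHull ends b h u := (hb.arm_sub P z hzP).1
  have hzh : z ≠ h := (hb.arm_sub P z hzP).2.1
  have hzu : z ≠ u := (hb.arm_sub P z hzP).2.2
  have h1 := hb.shadowReal_uZ huB ω' hz huz
  intro hsub
  by_cases hzo : z = o
  · -- the dropped vertex is the mark
    subst hzo
    rw [mem_tgtU_iff'] at hQ
    obtain ⟨_, hoA, _⟩ := hQ
    cases hn : ω' none with
    | true =>
      -- the red cluster of `o` stays in the dropped arms, which avoid `l`
      have hlo := conn_symm hoA
      have := hb.cluster_subset_sZ_of_none_true huB ω' hn hz hlo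
      obtain ⟨P', _, _, hlP'⟩ := this
      exact hl (hHU (hb.arm_sub P' l hlP').1)
    | false =>
      -- the edge `u z` is red: `l` is in the red cluster of `u`
      rw [hn] at h1
      have hred : shadowReal ends (sB ends u (armsFun S) (omegaSR S R))
          (sZ ends u (armsFun S) (omegaSR S R)) none (shadowOf ends u (armsFun S) (omegaSR S R) b)
          ω' e = true := by rw [h1]; rfl
      have hu := mem_cluster_of_edge hoA hred (ends_swap huz)
      exact hl (hsub (Or.inl (conn_symm hu)))
  · -- a dropped vertex other than the mark carries an outside edge
    rcases hout z (hHU hzH) hzh hzo hzu with ⟨e', y, hzy, hyU⟩ | hiso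
    · have hyH : y ∉ extHull ends b h u := fun hyH => hyU (hHU hyH)
      have h2 := hb.shadowReal_Z_out huB ω' hz hzy hyH
      cases hn : ω' none with
      | true =>
        rw [hn] at h1 h2
        have hb1 : blue (shadowReal ends (sB ends u (armsFun S) (omegaSR S R))
            (sZ ends u (armsFun S) (omegaSR S R)) none (shadowOf ends u (armsFun S) (omegaSR S R) b)
            ω') e = true := by rw [blue_apply, h1]; rfl
        have hb2 : blue (shadowReal ends (sB ends u (armsFun S) (omegaSR S R))
            (sZ ends u (armsFun S) (omegaSR S R)) none (shadowOf ends u (armsFun S) (omegaSR S R) b)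
            ω') e' = true := by rw [blue_apply, h2]; rfl
        have hz' := mem_cluster_of_edge (mem_cluster_self ends _ u) hb1 huz
        exact hyU (hsub (Or.inr (mem_cluster_of_edge hz' hb2 hzy)))
      | false =>
        rw [hn] at h1 h2
        have hr1 : shadowReal ends (sB ends u (armsFun S) (omegaSR S R))
            (sZ ends u (armsFun S) (omegaSR S R)) none (shadowOf ends u (armsFun S) (omegaSR S R) b)
            ω' e = true := by rw [h1]; rfl
        have hr2 : shadowReal ends (sB ends u (armsFun S) (omegaSR S R))
            (sZ ends u (armsFun S) (omegaSR S R)) none (shadowOf ends u (armsFun S) (omegaSR S R) b)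
            ω' e' = true := by rw [h2]; rfl
        have hz' := mem_cluster_of_edge (mem_cluster_self ends _ u) hr1 huz
        exact hyU (hsub (Or.inl (mem_cluster_of_edge hz' hr2 hzy)))
    · exact hiso e (by rw [huz]; exact Sym2.mem_mk_right u z)

include hb huB hS in
omit [DecidableEq E] in
/-- **The coarse flip of a point of a shadow block is an e-cube point of `b`.** -/
theorem psiOf_of_mem_shadowBlockE {ζ' : Config E} (hζ' : ζ' ∈ shadowBlock ends u b S R) :
    ∃ ω'', psiOf ends h u ζ' = coreRealE ends (armsFun S) h u b ω'' := by
  obtain ⟨ω', rfl⟩ := (mem_shadowBlock_iff).1 hζ'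
  have hconn : ArmsConnected (armsFun S) ends := by
    subst hS
    exact armsConnected_armsC b
  refine ⟨if ω' none = true then
    toggleE (uAdjC ends u (armsFun S)) (withHuRed (coreOf ends u (armsFun S) (omegaSR S R) ω'))
    else withHuRed (coreOf ends u (armsFun S) (omegaSR S R) ω'), ?_⟩
  unfold psiOf
  rw [hb.arm_u_eq_sX hconn (hb.hull_shadowReal_eq huB ω')]
  exact hb.flip_sX_shadowReal ω'

include hb huB hS in
omit [DecidableEq E] in
/-- **The base of a point of a shadow block is `b`.** -/
theorem baseOfE_of_mem_shadowBlock {ζ' : Config E} (hζ' : ζ' ∈ shadowBlock ends u b S R) :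
    baseOfE ends h u ζ' = b := by
  obtain ⟨ω'', hψ⟩ := psiOf_of_mem_shadowBlockE hS hb huB hζ'
  unfold baseOfE
  rw [hψ, hb.coreBaseOfE_coreRealE]

include hb huB hS in
omit [DecidableEq E] in
/-- **The arms of a point of a shadow block are `S`.** -/
theorem armsOf_of_mem_shadowBlockE {ζ' : Config E} (hζ' : ζ' ∈ shadowBlock ends u b S R) :
    armsOf ends h u ζ' = S := by
  obtain ⟨ω'', hψ⟩ := psiOf_of_mem_shadowBlockE hS hb huB hζ'
  unfold armsOf
  rw [hψ]
  subst hS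
  exact armsC_eq_of_extHull_eq (hb.extHull_coreRealE ω'')

include hb huB hS in
omit [DecidableEq E] in
/-- **The red arms of a point of a shadow block**: the arms of `S` that are not dropped. -/
theorem redOf_of_mem_shadowBlockE {ζ' : Config E} (hζ' : ζ' ∈ shadowBlock ends u b S R) :
    redOf ends h u ζ' = S.filter fun P => (∃ e x, ends e = s(u, x) ∧ x ∈ P) → P ∈ R := by
  have hA := armsOf_of_mem_shadowBlockE hS hb huB hζ'
  obtain ⟨ω', rfl⟩ := (mem_shadowBlock_iff).1 hζ'
  unfold redOf
  rw [hA, hb.hull_shadowReal_eq huB ω']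
  ext P
  simp only [Finset.mem_filter]
  constructor
  · rintro ⟨hP, x, hxP, hx⟩
    refine ⟨hP, fun hadj => ?_⟩
    have := (hb.mem_region_iff_of_mem_arm (ω₀ := omegaSR S R) (i := ⟨P, hP⟩) hxP).1 hx hadj
    exact omegaSR_eq_true_iff.1 this
  · rintro ⟨hP, hadj⟩
    obtain ⟨x, hxP⟩ := hb.arm_nonempty ⟨P, hP⟩
    refine ⟨hP, x, hxP, ?_⟩
    exact (hb.mem_region_iff_of_mem_arm (ω₀ := omegaSR S R) (i := ⟨P, hP⟩) hxP).2
      fun h' => omegaSR_eq_true_iff.2 (hadj h')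

end Key

end LocRows

end Summit.Ventures.PercRepro2
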